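import Mathlib
import Literature.MathematicalPhysics.QuantumLattice.HarmonicSeriesCalculus
import Literature.MathematicalPhysics.QuantumLattice.SymmetricRegimeFunctionals
import HarnessLib

/-!
# Jets of a countertermed band and their stability under `ℓ¹`-convergence of the coefficient table

For a coefficient table `c : ℕ × ℕ → ℝ` with `Σ (1+m+n)² |c_{mn}| < ∞` the continuum band
`e_c(p) = -2(cos p₁ + cos p₂) - μ - Σ' c_{mn} h_{mn}(p)` is `C²`.  This file identifies its first and
second partial derivatives (`partialD` of `SymmetricRegimeFunctionals.lean`), hence `gradSq e_c` and
`levelCurvature e_c`, with explicit absolutely convergent series, and proves that when tables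
`c_d → c_∞` in the weighted `ℓ¹` distance, `Σ (1+m+n)² |c_∞ - c_d| → 0`, the band, `gradSq` and (where
`∇e_{c_∞}(p₀) ≠ 0`) `levelCurvature` of `e_{c_d}` converge to those of `e_{c_∞}` locally uniformly, in
the filter form `Tendsto (fun (d, p) ↦ …) (atTop ×ˢ 𝓝 p₀) (𝓝 …)` consumed by compactness arguments
(`tendsto_band_jets`).

Elementary real analysis ([folklore]); no definitions are introduced (the band is written out).
-/

noncomputable section

namespace Literature.MathematicalPhysics.QuantumLattice

open _root_.Filter _root_.Topology Finset TrigPolyC4v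
open scoped BigOperators

/-! ### The bare part -/

/-- `D(-2(cos p₁ + cos p₂) - μ) v = 2 sin p₁ v₀ + 2 sin p₂ v₁`. [folklore] -/
theorem fderiv_bareBand (μ : ℝ) (p : Fin 2 → ℝ) :
    DifferentiableAt ℝ (fun p : Fin 2 → ℝ => -2 * (Real.cos (p 0) + Real.cos (p 1)) - μ) p ∧
      ∀ v, fderiv ℝ (fun p : Fin 2 → ℝ => -2 * (Real.cos (p 0) + Real.cos (p 1)) - μ) p v =
        2 * Real.sin (p 0) * v 0 + 2 * Real.sin (p 1) * v 1 := by
  have h := (((hasFDerivAt_cos_coord 0 p).add (hasFDerivAt_cos_coord 1 p)).const_mul (-2 : ℝ)).sub_const μ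
  have h' := h.congr_of_eventuallyEq (f₁ := fun p : Fin 2 → ℝ => -2 * (Real.cos (p 0) + Real.cos (p 1)) - μ)
    (Eventually.of_forall fun y => by simp only [Pi.add_apply])
  refine ⟨h'.differentiableAt, fun v => ?_⟩
  rw [h'.fderiv]
  simp; ring

/-- `D(2 sin pᵢ) v = 2 cos pᵢ vᵢ`. [folklore] -/
theorem fderiv_two_mul_sin_coord (i : Fin 2) (p : Fin 2 → ℝ) :
    DifferentiableAt ℝ (fun p : Fin 2 → ℝ => 2 * Real.sin (p i)) p ∧
      ∀ v, fderiv ℝ (fun p : Fin 2 → ℝ => 2 * Real.sin (p i)) p v = 2 * Real.cos (p i) * v i := by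
  have h := (hasFDerivAt_sin_coord i p).const_mul (2 : ℝ)
  refine ⟨h.differentiableAt, fun v => ?_⟩
  rw [h.fderiv]
  simp; ring

/-- **Derivative of `B - Σ' c q φ q`** for a differentiable `B` and a termwise differentiable weighted
series: `D(B - Σ' c φ)(p) v = (b₀ - Σ' c φ₀) v₀ + (b₁ - Σ' c φ₁) v₁`. [folklore] -/
theorem fderiv_sub_tsum_mul_weight {B : (Fin 2 → ℝ) → ℝ} {b₀ b₁ : ℝ} {p : Fin 2 → ℝ}
    (hB : DifferentiableAt ℝ B p) (hBv : ∀ v, fderiv ℝ B p v = b₀ * v 0 + b₁ * v 1) {c : ℕ × ℕ → ℝ}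
    (hc : Summable fun q : ℕ × ℕ => ((1 : ℝ) + q.1 + q.2) ^ 2 * |c q|)
    {φ φ₀ φ₁ : ℕ × ℕ → (Fin 2 → ℝ) → ℝ} (hd : ∀ q p, DifferentiableAt ℝ (φ q) p)
    (hφ : ∀ q p v, fderiv ℝ (φ q) p v = φ₀ q p * v 0 + φ₁ q p * v 1)
    (hb : ∀ q p, |φ q p| ≤ ((1 : ℝ) + q.1 + q.2) ^ 2) (hb₀ : ∀ q p, |φ₀ q p| ≤ ((1 : ℝ) + q.1 + q.2) ^ 2)
    (hb₁ : ∀ q p, |φ₁ q p| ≤ ((1 : ℝ) + q.1 + q.2) ^ 2) :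
    DifferentiableAt ℝ (fun p => B p - ∑' q, c q * φ q p) p ∧
      ∀ v, fderiv ℝ (fun p => B p - ∑' q, c q * φ q p) p v =
        (b₀ - ∑' q, c q * φ₀ q p) * v 0 + (b₁ - ∑' q, c q * φ₁ q p) * v 1 := by
  obtain ⟨hS, hSv⟩ := fderiv_tsum_mul_weight hc hd hφ hb hb₀ hb₁ p
  have h := hB.hasFDerivAt.fun_sub hS.hasFDerivAt
  refine ⟨h.differentiableAt, fun v => ?_⟩
  rw [h.fderiv, FunLike.coe_sub, Pi.sub_apply, hBv, hSv]
  ring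

/-! ### The band of a summable table: first and second derivatives -/

/-- **The band is differentiable**, `De_c(p) v = Σᵢ (2 sin pᵢ - Σ' c q ∂ᵢh_q(p)) vᵢ`. [folklore] -/
theorem fderiv_band (μ : ℝ) {c : ℕ × ℕ → ℝ}
    (hc : Summable fun q : ℕ × ℕ => ((1 : ℝ) + q.1 + q.2) ^ 2 * |c q|) (p : Fin 2 → ℝ) :
    DifferentiableAt ℝ (fun p : Fin 2 → ℝ => -2 * (Real.cos (p 0) + Real.cos (p 1)) - μ -
        ∑' q : ℕ × ℕ, c q * harmonic q.1 q.2 p) p ∧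
      ∀ v, fderiv ℝ (fun p : Fin 2 → ℝ => -2 * (Real.cos (p 0) + Real.cos (p 1)) - μ -
          ∑' q : ℕ × ℕ, c q * harmonic q.1 q.2 p) p v =
        (2 * Real.sin (p 0) - ∑' q : ℕ × ℕ, c q * harmonicGrad q.1 q.2 p 0) * v 0 +
          (2 * Real.sin (p 1) - ∑' q : ℕ × ℕ, c q * harmonicGrad q.1 q.2 p 1) * v 1 :=
  fderiv_sub_tsum_mul_weight (fderiv_bareBand μ p).1 (fderiv_bareBand μ p).2 hc
    (φ := fun q p => harmonic q.1 q.2 p) (fun q p => (fderiv_harmonic q.1 q.2 p).1)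
    (fun q p => (fderiv_harmonic q.1 q.2 p).2) abs_harmonic_le_weight
    (fun q p => abs_harmonicGrad_le_weight q p 0) (fun q p => abs_harmonicGrad_le_weight q p 1)

/-- **First row of second derivatives of the band**:
`D(∂₁e_c)(p) v = (2cos p₁ - Σ' c ∂₁∂₁h) v₀ + (0 - Σ' c ∂₁∂₂h) v₁`. [folklore] -/
theorem fderiv_bandGrad_fst {c : ℕ × ℕ → ℝ}
    (hc : Summable fun q : ℕ × ℕ => ((1 : ℝ) + q.1 + q.2) ^ 2 * |c q|) (p : Fin 2 → ℝ) :
    DifferentiableAt ℝ (fun p : Fin 2 → ℝ => 2 * Real.sin (p 0) - ∑' q : ℕ × ℕ, c q * harmonicGrad q.1 q.2 p 0) p ∧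
      ∀ v, fderiv ℝ (fun p : Fin 2 → ℝ => 2 * Real.sin (p 0) - ∑' q : ℕ × ℕ, c q * harmonicGrad q.1 q.2 p 0) p v =
        (2 * Real.cos (p 0) - ∑' q : ℕ × ℕ, c q *
            -((((q.1 : ℝ) ^ 2 * Real.cos (q.1 * p 0) * Real.cos (q.2 * p 1) +
              (q.2 : ℝ) ^ 2 * Real.cos (q.2 * p 0) * Real.cos (q.1 * p 1)) / 2))) * v 0 +
          (0 - ∑' q : ℕ × ℕ, c q * ((q.1 : ℝ) * q.2 *
            (Real.sin (q.1 * p 0) * Real.sin (q.2 * p 1) + Real.sin (q.2 * p 0) * Real.sin (q.1 * p 1)) / 2)) *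
            v 1 :=
  fderiv_sub_tsum_mul_weight (fderiv_two_mul_sin_coord 0 p).1
    (fun v => by rw [(fderiv_two_mul_sin_coord 0 p).2 v]; ring) hc (φ := fun q p => harmonicGrad q.1 q.2 p 0)
    (fun q p => (fderiv_harmonicGrad_fst q.1 q.2 p).1) (fun q p => (fderiv_harmonicGrad_fst q.1 q.2 p).2)
    (fun q p => abs_harmonicGrad_le_weight q p 0) abs_hxx_le_weight abs_hxy_le_weight

/-- **Second row of second derivatives of the band**:
`D(∂₂e_c)(p) v = (0 - Σ' c ∂₁∂₂h) v₀ + (2cos p₂ - Σ' c ∂₂∂₂h) v₁`. [folklore] -/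
theorem fderiv_bandGrad_snd {c : ℕ × ℕ → ℝ}
    (hc : Summable fun q : ℕ × ℕ => ((1 : ℝ) + q.1 + q.2) ^ 2 * |c q|) (p : Fin 2 → ℝ) :
    DifferentiableAt ℝ (fun p : Fin 2 → ℝ => 2 * Real.sin (p 1) - ∑' q : ℕ × ℕ, c q * harmonicGrad q.1 q.2 p 1) p ∧
      ∀ v, fderiv ℝ (fun p : Fin 2 → ℝ => 2 * Real.sin (p 1) - ∑' q : ℕ × ℕ, c q * harmonicGrad q.1 q.2 p 1) p v =
        (0 - ∑' q : ℕ × ℕ, c q * ((q.1 : ℝ) * q.2 *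
            (Real.sin (q.1 * p 0) * Real.sin (q.2 * p 1) + Real.sin (q.2 * p 0) * Real.sin (q.1 * p 1)) / 2)) *
            v 0 +
          (2 * Real.cos (p 1) - ∑' q : ℕ × ℕ, c q *
            -((((q.2 : ℝ) ^ 2 * Real.cos (q.1 * p 0) * Real.cos (q.2 * p 1) +
              (q.1 : ℝ) ^ 2 * Real.cos (q.2 * p 0) * Real.cos (q.1 * p 1)) / 2))) * v 1 :=
  fderiv_sub_tsum_mul_weight (fderiv_two_mul_sin_coord 1 p).1
    (fun v => by rw [(fderiv_two_mul_sin_coord 1 p).2 v]; ring) hc (φ := fun q p => harmonicGrad q.1 q.2 p 1)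
    (fun q p => (fderiv_harmonicGrad_snd q.1 q.2 p).1) (fun q p => (fderiv_harmonicGrad_snd q.1 q.2 p).2)
    (fun q p => abs_harmonicGrad_le_weight q p 1) abs_hxy_le_weight abs_hyy_le_weight

/-! ### From derivatives in evaluated form to `partialD`, `gradSq`, `levelCurvature` -/

/-- **Jets from derivatives in evaluated form**: if `De(p) v = g₀ v₀ + g₁ v₁`,
`Dg₀(p) v = g₀₀ v₀ + g₀₁ v₁` and `Dg₁(p) v = g₁₀ v₀ + g₁₁ v₁` everywhere, then the `partialD`-jets of `e`
are `g₀, g₁, g₀₀, g₁₀, g₁₁`. [folklore] -/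
theorem partialD_of_fderiv {e g₀ g₁ g₀₀ g₀₁ g₁₀ g₁₁ : (Fin 2 → ℝ) → ℝ}
    (he : ∀ p v, fderiv ℝ e p v = g₀ p * v 0 + g₁ p * v 1)
    (h₀ : ∀ p v, fderiv ℝ g₀ p v = g₀₀ p * v 0 + g₀₁ p * v 1)
    (h₁ : ∀ p v, fderiv ℝ g₁ p v = g₁₀ p * v 0 + g₁₁ p * v 1) (p : Fin 2 → ℝ) :
    partialD 0 e p = g₀ p ∧ partialD 1 e p = g₁ p ∧ partialD 0 (partialD 0 e) p = g₀₀ p ∧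
      partialD 0 (partialD 1 e) p = g₁₀ p ∧ partialD 1 (partialD 1 e) p = g₁₁ p := by
  have e₀ : partialD 0 e = g₀ := funext fun p => by simp [partialD, he]
  have e₁ : partialD 1 e = g₁ := funext fun p => by simp [partialD, he]
  refine ⟨by rw [e₀], by rw [e₁], ?_, ?_, ?_⟩
  · rw [e₀, partialD]; simp [h₀]
  · rw [e₁, partialD]; simp [h₁]
  · rw [e₁, partialD]; simp [h₁]

/-- `gradSq` from a derivative in evaluated form. [folklore] -/
theorem gradSq_of_fderiv {e g₀ g₁ : (Fin 2 → ℝ) → ℝ} (he : ∀ p v, fderiv ℝ e p v = g₀ p * v 0 + g₁ p * v 1)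
    (p : Fin 2 → ℝ) : gradSq e p = g₀ p ^ 2 + g₁ p ^ 2 := by
  simp [gradSq, partialD, he]

/-- `levelCurvature` from derivatives in evaluated form. [folklore] -/
theorem levelCurvature_of_fderiv {e g₀ g₁ g₀₀ g₀₁ g₁₀ g₁₁ : (Fin 2 → ℝ) → ℝ}
    (he : ∀ p v, fderiv ℝ e p v = g₀ p * v 0 + g₁ p * v 1)
    (h₀ : ∀ p v, fderiv ℝ g₀ p v = g₀₀ p * v 0 + g₀₁ p * v 1)
    (h₁ : ∀ p v, fderiv ℝ g₁ p v = g₁₀ p * v 0 + g₁₁ p * v 1) (p : Fin 2 → ℝ) :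
    levelCurvature e p = (g₀₀ p * g₁ p ^ 2 - 2 * g₁₀ p * g₀ p * g₁ p + g₁₁ p * g₀ p ^ 2) /
      (g₀ p ^ 2 + g₁ p ^ 2) ^ ((3 : ℝ) / 2) := by
  obtain ⟨a, b, c, d, f⟩ := partialD_of_fderiv he h₀ h₁ p
  rw [levelCurvature, gradSq_of_fderiv he, a, b, c, d, f]

/-! ### Locally uniform convergence -/

/-- A uniformly convergent sequence with continuous limit converges along `atTop ×ˢ 𝓝 x₀`:
`F d x → f x₀` as `d → ∞, x → x₀`. [folklore] -/
theorem tendsto_prod_nhds_of_uniform {X : Type*} [TopologicalSpace X] {F : ℕ → X → ℝ} {f : X → ℝ}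
    {t : ℕ → ℝ} (ht : Tendsto t atTop (𝓝 0)) (hb : ∀ d x, |F d x - f x| ≤ t d) {x₀ : X}
    (hf : ContinuousAt f x₀) : Tendsto (fun z : ℕ × X => F z.1 z.2) (atTop ×ˢ 𝓝 x₀) (𝓝 (f x₀)) := by
  rw [Metric.tendsto_nhds]
  intro ε hε
  have h1 : ∀ᶠ d in atTop, t d < ε / 2 := (tendsto_order.1 ht).2 _ (by linarith)
  have h2 : ∀ᶠ x in 𝓝 x₀, dist (f x) (f x₀) < ε / 2 := Metric.tendsto_nhds.1 hf _ (by linarith)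
  filter_upwards [h1.prod_mk h2] with z hz
  calc dist (F z.1 z.2) (f x₀) ≤ dist (F z.1 z.2) (f z.2) + dist (f z.2) (f x₀) := dist_triangle _ _ _
    _ < ε / 2 + ε / 2 := by
        gcongr
        · exact lt_of_le_of_lt (by rw [Real.dist_eq]; exact hb _ _) hz.1
        · exact hz.2
    _ = ε := by ring

/-- **Locally uniform `C²` stability of the band under weighted `ℓ¹` convergence of its table**:
if `Σ_q (1+q₁+q₂)² |c_∞(q) - c_d(q)| → 0` then, as `(d, p) → (∞, p₀)`, the band `e_{c_d}(p)`, its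
squared speed `gradSq` and — where `∇e_{c_∞}(p₀) ≠ 0` — its level curvature converge to the values
of `e_{c_∞}` at `p₀`. [folklore] -/
theorem tendsto_band_jets {c : ℕ → ℕ × ℕ → ℝ} {cinf : ℕ × ℕ → ℝ}
    (hc : ∀ d, Summable fun q : ℕ × ℕ => ((1 : ℝ) + q.1 + q.2) ^ 2 * |c d q|)
    (hci : Summable fun q : ℕ × ℕ => ((1 : ℝ) + q.1 + q.2) ^ 2 * |cinf q|)
    (ht : Tendsto (fun d => ∑' q : ℕ × ℕ, ((1 : ℝ) + q.1 + q.2) ^ 2 * |cinf q - c d q|) atTop (𝓝 0))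
    (μ : ℝ) (p₀ : Fin 2 → ℝ) :
    Tendsto (fun z : ℕ × (Fin 2 → ℝ) => -2 * (Real.cos (z.2 0) + Real.cos (z.2 1)) - μ -
        ∑' q : ℕ × ℕ, c z.1 q * harmonic q.1 q.2 z.2) (atTop ×ˢ 𝓝 p₀)
        (𝓝 (-2 * (Real.cos (p₀ 0) + Real.cos (p₀ 1)) - μ - ∑' q : ℕ × ℕ, cinf q * harmonic q.1 q.2 p₀)) ∧
      Tendsto (fun z : ℕ × (Fin 2 → ℝ) => gradSq (fun p : Fin 2 → ℝ => -2 * (Real.cos (p 0) + Real.cos (p 1)) -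
          μ - ∑' q : ℕ × ℕ, c z.1 q * harmonic q.1 q.2 p) z.2) (atTop ×ˢ 𝓝 p₀)
        (𝓝 (gradSq (fun p : Fin 2 → ℝ => -2 * (Real.cos (p 0) + Real.cos (p 1)) - μ -
          ∑' q : ℕ × ℕ, cinf q * harmonic q.1 q.2 p) p₀)) ∧
      (gradSq (fun p : Fin 2 → ℝ => -2 * (Real.cos (p 0) + Real.cos (p 1)) - μ -
          ∑' q : ℕ × ℕ, cinf q * harmonic q.1 q.2 p) p₀ ≠ 0 →
        Tendsto (fun z : ℕ × (Fin 2 → ℝ) => levelCurvature (fun p : Fin 2 → ℝ =>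
            -2 * (Real.cos (p 0) + Real.cos (p 1)) - μ - ∑' q : ℕ × ℕ, c z.1 q * harmonic q.1 q.2 p) z.2)
          (atTop ×ˢ 𝓝 p₀)
          (𝓝 (levelCurvature (fun p : Fin 2 → ℝ => -2 * (Real.cos (p 0) + Real.cos (p 1)) - μ -
            ∑' q : ℕ × ℕ, cinf q * harmonic q.1 q.2 p) p₀))) := by
  -- generic jet `B - Σ' c φ`: uniform bound by the table distance + continuity of the limit
  have key : ∀ (B : (Fin 2 → ℝ) → ℝ) (φ : ℕ × ℕ → (Fin 2 → ℝ) → ℝ), Continuous B →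
      (∀ q, Continuous (φ q)) → (∀ q p, |φ q p| ≤ ((1 : ℝ) + q.1 + q.2) ^ 2) →
      Tendsto (fun z : ℕ × (Fin 2 → ℝ) => B z.2 - ∑' q, c z.1 q * φ q z.2) (atTop ×ˢ 𝓝 p₀)
        (𝓝 (B p₀ - ∑' q, cinf q * φ q p₀)) := by
    intro B φ hB hφ hb
    refine tendsto_prod_nhds_of_uniform (F := fun d x => B x - ∑' q, c d q * φ q x)
      (f := fun x => B x - ∑' q, cinf q * φ q x) ht (fun d x => ?_)
      (hB.sub (continuous_tsum_mul_weight hci hφ hb)).continuousAt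
    rw [show B x - ∑' q, c d q * φ q x - (B x - ∑' q, cinf q * φ q x) =
      ∑' q, cinf q * φ q x - ∑' q, c d q * φ q x by ring]
    exact abs_tsum_mul_sub_le_weight hci (hc d) fun q => hb q x
  have cH : ∀ q : ℕ × ℕ, Continuous fun p : Fin 2 → ℝ => harmonic q.1 q.2 p := fun q =>
    continuous_iff_continuousAt.2 fun p => (fderiv_harmonic q.1 q.2 p).1.continuousAt
  have cG0 : ∀ q : ℕ × ℕ, Continuous fun p : Fin 2 → ℝ => harmonicGrad q.1 q.2 p 0 := fun q =>
    continuous_iff_continuousAt.2 fun p => (fderiv_harmonicGrad_fst q.1 q.2 p).1.continuousAt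
  have cG1 : ∀ q : ℕ × ℕ, Continuous fun p : Fin 2 → ℝ => harmonicGrad q.1 q.2 p 1 := fun q =>
    continuous_iff_continuousAt.2 fun p => (fderiv_harmonicGrad_snd q.1 q.2 p).1.continuousAt
  have T0 := key (fun p => -2 * (Real.cos (p 0) + Real.cos (p 1)) - μ) (fun q p => harmonic q.1 q.2 p)
    (by fun_prop) cH abs_harmonic_le_weight
  have T1 := key (fun p => 2 * Real.sin (p 0)) (fun q p => harmonicGrad q.1 q.2 p 0) (by fun_prop) cG0
    (fun q p => abs_harmonicGrad_le_weight q p 0)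
  have T2 := key (fun p => 2 * Real.sin (p 1)) (fun q p => harmonicGrad q.1 q.2 p 1) (by fun_prop) cG1
    (fun q p => abs_harmonicGrad_le_weight q p 1)
  have T11 := key (fun p => 2 * Real.cos (p 0)) (fun q p => -((((q.1 : ℝ) ^ 2 * Real.cos (q.1 * p 0) *
      Real.cos (q.2 * p 1) + (q.2 : ℝ) ^ 2 * Real.cos (q.2 * p 0) * Real.cos (q.1 * p 1)) / 2)))
    (by fun_prop) (fun q => by fun_prop) abs_hxx_le_weight
  have T12 := key (fun _ => 0) (fun q p => (q.1 : ℝ) * q.2 *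
      (Real.sin (q.1 * p 0) * Real.sin (q.2 * p 1) + Real.sin (q.2 * p 0) * Real.sin (q.1 * p 1)) / 2)
    (by fun_prop) (fun q => by fun_prop) abs_hxy_le_weight
  have T22 := key (fun p => 2 * Real.cos (p 1)) (fun q p => -((((q.2 : ℝ) ^ 2 * Real.cos (q.1 * p 0) *
      Real.cos (q.2 * p 1) + (q.1 : ℝ) ^ 2 * Real.cos (q.2 * p 0) * Real.cos (q.1 * p 1)) / 2)))
    (by fun_prop) (fun q => by fun_prop) abs_hyy_le_weight
  have hg : ∀ c' : ℕ × ℕ → ℝ, (Summable fun q : ℕ × ℕ => ((1 : ℝ) + q.1 + q.2) ^ 2 * |c' q|) → ∀ p,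
      gradSq (fun p : Fin 2 → ℝ => -2 * (Real.cos (p 0) + Real.cos (p 1)) - μ -
        ∑' q : ℕ × ℕ, c' q * harmonic q.1 q.2 p) p =
      (2 * Real.sin (p 0) - ∑' q, c' q * harmonicGrad q.1 q.2 p 0) ^ 2 +
        (2 * Real.sin (p 1) - ∑' q, c' q * harmonicGrad q.1 q.2 p 1) ^ 2 :=
    fun c' hc' p => gradSq_of_fderiv (fun p => (fderiv_band μ hc' p).2) p
  have hk : ∀ c' : ℕ × ℕ → ℝ, (Summable fun q : ℕ × ℕ => ((1 : ℝ) + q.1 + q.2) ^ 2 * |c' q|) → ∀ p,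
      levelCurvature (fun p : Fin 2 → ℝ => -2 * (Real.cos (p 0) + Real.cos (p 1)) - μ -
        ∑' q : ℕ × ℕ, c' q * harmonic q.1 q.2 p) p =
      ((2 * Real.cos (p 0) - ∑' q : ℕ × ℕ, c' q *
            -((((q.1 : ℝ) ^ 2 * Real.cos (q.1 * p 0) * Real.cos (q.2 * p 1) +
              (q.2 : ℝ) ^ 2 * Real.cos (q.2 * p 0) * Real.cos (q.1 * p 1)) / 2))) *
            (2 * Real.sin (p 1) - ∑' q, c' q * harmonicGrad q.1 q.2 p 1) ^ 2 -
          2 * (0 - ∑' q : ℕ × ℕ, c' q * ((q.1 : ℝ) * q.2 *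
            (Real.sin (q.1 * p 0) * Real.sin (q.2 * p 1) + Real.sin (q.2 * p 0) * Real.sin (q.1 * p 1)) / 2)) *
            (2 * Real.sin (p 0) - ∑' q, c' q * harmonicGrad q.1 q.2 p 0) *
            (2 * Real.sin (p 1) - ∑' q, c' q * harmonicGrad q.1 q.2 p 1) +
        (2 * Real.cos (p 1) - ∑' q : ℕ × ℕ, c' q *
            -((((q.2 : ℝ) ^ 2 * Real.cos (q.1 * p 0) * Real.cos (q.2 * p 1) +
              (q.1 : ℝ) ^ 2 * Real.cos (q.2 * p 0) * Real.cos (q.1 * p 1)) / 2))) *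
          (2 * Real.sin (p 0) - ∑' q, c' q * harmonicGrad q.1 q.2 p 0) ^ 2) /
      ((2 * Real.sin (p 0) - ∑' q, c' q * harmonicGrad q.1 q.2 p 0) ^ 2 +
        (2 * Real.sin (p 1) - ∑' q, c' q * harmonicGrad q.1 q.2 p 1) ^ 2) ^ ((3 : ℝ) / 2) :=
    fun c' hc' p => levelCurvature_of_fderiv (fun p => (fderiv_band μ hc' p).2)
      (fun p => (fderiv_bandGrad_fst hc' p).2) (fun p => (fderiv_bandGrad_snd hc' p).2) p
  refine ⟨T0, ?_, fun hG => ?_⟩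
  · rw [hg cinf hci]
    exact ((T1.pow 2).add (T2.pow 2)).congr fun z => (hg _ (hc z.1) z.2).symm
  · rw [hk cinf hci]
    rw [hg cinf hci] at hG
    have hpos : 0 < (2 * Real.sin (p₀ 0) - ∑' q, cinf q * harmonicGrad q.1 q.2 p₀ 0) ^ 2 +
        (2 * Real.sin (p₀ 1) - ∑' q, cinf q * harmonicGrad q.1 q.2 p₀ 1) ^ 2 :=
      lt_of_le_of_ne (by positivity) (Ne.symm hG)
    have hN := ((T11.mul (T2.pow 2)).sub (((T12.const_mul 2).mul T1).mul T2)).add (T22.mul (T1.pow 2))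
    have hD := ((T1.pow 2).add (T2.pow 2)).rpow_const (p := (3 : ℝ) / 2) (Or.inl hG)
    exact (hN.div hD (Real.rpow_pos_of_pos hpos _).ne').congr fun z => (hk _ (hc z.1) z.2).symm

end Literature.MathematicalPhysics.QuantumLattice
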